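import Summits.AnomalousDissipation.AnomalousDissipation.Theorems.FloorCertificate.Negative.Uniform
import Literature.Analysis.FluidPDE.EnergySpaceRellich
import Literature.Analysis.FluidPDE.CylindricalGenerator
import Mathlib.MeasureTheory.Measure.Prokhorov

/-!
# Line `dissipation-deficit-duality` for crux `TaylorCertificates.FloorCertificate`
# (stmt-AnomalousDissipation-14091) — LEAD'S SKELETON (reshape 1, 2026-08-16)

Line lead `prover-line-stmt-AnomalousDissipation-14091-0`, built on the checked crux-plan skeleton
`Cruxes/FloorCertificate/Lines/dissipation-deficit-duality.lean` (planner-cruxplan-…-dissipation-deficit--0)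
and its line card `Lines/dissipation-deficit-duality.md`; PICKED over `marchioro-force-floor`
(`Cruxes/FloorCertificate/PICKED.md`).

## The line

THE CERTIFICATE CLASS OF THE CRUX IS THE EXACT LAGRANGIAN DUAL OF RELAXED STATIONARY STATISTICS, AND FOR
THE DISSIPATION FLOOR THE DUALITY GAP IS ZERO. At fixed `(f, ν)` the crux is a linear programme over Borel
probability measures on the Leray ball `B = {u ∈ H : |u|² ≤ 16‖f‖²/ν²}`: minimise the mean dissipation
`ε(μ) = ν∫‖∇u‖²dμ` subject to the cylindrical Liouville equalities `∫⟨F(u),Φ'(u)⟩dμ = 0` (free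
multiplier `Φ₁`) and the ONE global energy inequality `ν∫‖∇u‖² ≤ ∫(u,f)` (signed multiplier `θ₁ ≤ 0`);
the Lagrangian is literally the crux's right-hand side. Feasible points = RELAXED STATIONARY STATISTICS
(`IsRelaxedStatistic`). Weak duality is PROVED (`weak_duality`); the line is the converse (strong duality,
stubs S0–S4, all provable now) plus the one physics bet S5 (uniform loudness of the relaxed statistics of
ONE force — the ensemble zeroth-law floor, OPEN, held by the lead).

## Reshape 1 (lead): seven registered stubs, TREE VOCABULARY ONLY

Every stub below is stated over tree declarations only (`Torus.energySpace`, `Torus.ensembleEnstrophy`,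
`Torus.ensembleDissipation`, `Torus.nsGeneratorPairing`, `Torus.pairing`, `Torus.CylindricalTest.grad`,
`ProbabilityMeasure`, and the LANDED `Negative.FloorIneq`), so that each lands verbatim as
`Theorems/TaylorCertificatesFloorCertificate<Stub>.lean --supports stmt-AnomalousDissipation-14091` and the
local vocabulary of the composition (`IsRelaxedStatistic`, `IsApproxRelaxed`, …) is bridged by `Iff.rfl`.
Relative to the planner's five stubs: (i) NEW S0 `stub_lscEnstrophy` — lower semicontinuity of the mean
enstrophy on `ProbabilityMeasure H` (the lemma S1, S3 and S4 all need; factored once); (ii) NEW S3a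
`stub_cylindricalCombination` — linear combinations `aΦ₁ + bΦ₂` of cylindrical test functionals realised
ON A BALL by one `CylindricalTest` (the concave-likeness device of S3 AND the `±kΦ` scaling of S4);
(iii) S1, S3, S4 take their sister stubs as explicit hypotheses (no worker waits for another);
(iv) S5 restated over the unbundled relaxed class (same content). Composition `FloorCertificate_of`
unchanged in idea: S5 gives `(f, ε₀, ν₀)`; answer the crux with `ε₀/2`; if no certificate existed at some
`ν < ν₀`, S3 at `(L, γ, η) = (n, 3ε₀/4, ε₀/8)` gives `(n, 7ε₀/8)`-approximately relaxed statistics for all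
`n`, S4 an exact relaxed statistic of dissipation `≤ 7ε₀/8`, contradicting S5.

Disproof.lean (cdisprove v2; landed as `Negative/{WeakDuality, UniformTools, Uniform}.lean`, imported):
no `_false_without_` theorem; §C weak duality = `weak_duality` below restricted to FMRT statistics
(`isRelaxed_of_isStationary`); §B/§D/§E honoured as in the planner's skeleton (certificates here are
`ν`-dependent with unbounded slope; `FloorCertificateUniform` is not an instance of any stub).
-/

noncomputable section

set_option linter.dupNamespace false

namespace Summit.AnomalousDissipation.AnomalousDissipation.Cruxes.FloorCertificate.DissipationDeficitDuality

open MeasureTheory Filter Topology UnitAddTorus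
open scoped InnerProductSpace ENNReal
open Literature.Analysis.FunctionSpaces Literature.Analysis.FluidPDE
open Summit.AnomalousDissipation.AnomalousDissipation.Theses.TaylorCertificates
open Summit.AnomalousDissipation.AnomalousDissipation.Theorems.FloorCertificate.Negative

/-- Local notation: real vector fields on `T³`. -/
local notation "Vec3" => (UnitAddTorus (Fin 3)) → (EuclideanSpace ℝ (Fin 3))
/-- Local notation: `L²(T³; ℝ³)`. -/
local notation "L2" => (Lp (EuclideanSpace ℝ (Fin 3)) 2 (volume : Measure (UnitAddTorus (Fin 3))))
/-- Local notation: the energy space `H` (Borel σ-algebra from `StatisticalSolution.lean`). -/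
local notation "H3" => (Torus.energySpace (Fin 3))

/-! ## The stubs (S0, S1, S2, S3a, S3, S4 provable now; S5 open) — tree vocabulary only -/

/-- **S0 `stub_lscEnstrophy`** — the mean enstrophy `μ ↦ ∫⁻ ‖∇u‖² dμ` is LOWER SEMICONTINUOUS on
`ProbabilityMeasure H` (topology of weak convergence). Why true: the spectral enstrophy
`u ↦ ‖∇u‖² = 4π² Σₖ |k|² ‖û(k)‖²` is the directed supremum, over finite frequency sets `s` and caps
`N : ℕ`, of the BOUNDED CONTINUOUS functions `h_{s,N}(u) = min(N, 4π² Σ_{k∈s} |k|²‖û(k)‖²)` (each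
`u ↦ û(k)` is continuous on `H`: `Torus.continuous_mFourierCoeff_complexify_coe`, cf. the proof of
`Torus.lowerSemicontinuous_eGradNormSq_coe`); `∫⁻ h_{s,N} dμ` is continuous in `μ`
(`FiniteMeasure.continuous_testAgainstNN_eval` ∘ `ProbabilityMeasure.toFiniteMeasure_continuous`), the
supremum commutes with `∫⁻` (`lintegral_iSup_directed_of_measurable`, countable index), and a supremum of
continuous functions is lower semicontinuous (`lowerSemicontinuous_iSup`). Size M. -/
theorem stub_lscEnstrophy :
    LowerSemicontinuous fun μ : ProbabilityMeasure (Torus.energySpace (Fin 3)) =>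
      Torus.ensembleEnstrophy (μ : Measure (Torus.energySpace (Fin 3))) := by
  sorry

/-- **S1 `stub_sublevelCompact`** — DISSIPATION IS ITS OWN TIGHTNESS: given S0, for every radius `ρ`
and finite level `c` the probability measures carried by the ball `{|u|² ≤ ρ}` with mean enstrophy `≤ c`
form a COMPACT subset of `ProbabilityMeasure H`. Why true: TIGHT — for `μ` in the set and `t > 0`,
`K_t = {|u|² ≤ ρ} ∩ {‖∇u‖² ≤ t}` is norm-compact in `H` (Rellich `Torus.isCompact_setOf_eGradNormSq_le`
∩ closed ball) and `μ(K_tᶜ) ≤ μ{‖∇u‖² > t} ≤ c/t` (Markov `mul_meas_ge_le_lintegral₀`,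
`Torus.measurable_eGradNormSq_coe`); relatively compact by Prokhorov (Mathlib
`isCompact_closure_of_isTightMeasureSet`, T2 + Borel suffice); CLOSED — `{∫⁻‖∇u‖² ≤ c}` is a sublevel set
of the lsc map S0 (`LowerSemicontinuous.isClosed_preimage`), and "carried by the closed ball" is closed
under weak limits along any filter (portmanteau `ProbabilityMeasure.limsup_measure_closed_le_of_tendsto`
with the closed ball: `1 = limsup μ'(ball) ≤ μ(ball)`); conclude with `IsCompact.of_isClosed_subset`.
Size M. -/
theorem stub_sublevelCompact :
    (LowerSemicontinuous fun μ : ProbabilityMeasure (Torus.energySpace (Fin 3)) =>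
      Torus.ensembleEnstrophy (μ : Measure (Torus.energySpace (Fin 3)))) →
    ∀ (ρ : ℝ) (c : ℝ≥0∞), c ≠ ⊤ →
      IsCompact {μ : ProbabilityMeasure (Torus.energySpace (Fin 3)) |
        (∀ᵐ u ∂(μ : Measure (Torus.energySpace (Fin 3))), ‖u‖ ^ 2 ≤ ρ) ∧
          Torus.ensembleEnstrophy (μ : Measure (Torus.energySpace (Fin 3))) ≤ c} := by
  sorry

/-- **S2 `stub_fanMinimax`** — KY FAN'S CONVEX-LIKE MINIMAX PRINCIPLE (Fan 1953, Thm 2; `γ`-form):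
`X` compact, `Y` nonempty, `φ(·, y)` lower semicontinuous, `φ` convex-like in `x` and concave-like in
`y`; if every `x` is beaten by some `y` above `γ`, one `y` beats every `x` above `γ`. Why true = Fan's
proof: the closed sets `C_y = {x : φ(x,y) ≤ γ}` have empty intersection, so by compactness finitely many
`y₁ … yₙ` have `maxᵢ φ(x, yᵢ) > γ` for all `x`, indeed `≥ β > γ` (an lsc function attains its min on a
compact set; `X = ∅` is trivial via `Nonempty Y`); the set `E = {z ∈ ℝⁿ : ∃ x, ∀ i, φ(x,yᵢ) ≤ zᵢ}` is
convex (convex-likeness in `x`) and misses the open convex box `{z : ∀ i, zᵢ < β}`; separate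
(`geometric_hahn_banach_open`; template `Literature/Analysis/Convex/MinMax.lean`): weights `λᵢ ≥ 0`,
`Σλᵢ = 1`, `Σλᵢ φ(x,yᵢ) ≥ β` for all `x`; concave-likeness in `y`, iterated to `n` points by induction,
gives `y₀` with `φ(x, y₀) ≥ Σλᵢ φ(x,yᵢ) ≥ β > γ`. [Fan, PNAS 39 (1953) 42–47, Thm 2; Sion 1958.]
Size M–L; reusable (worth a copy under `Literature/Analysis/Convex/`). -/
theorem stub_fanMinimax :
    ∀ (X Y : Type) [TopologicalSpace X] [CompactSpace X] [Nonempty Y] (φ : X → Y → ℝ),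
      (∀ y : Y, LowerSemicontinuous fun x : X => φ x y) →
      (∀ (x₁ x₂ : X) (t : ℝ), 0 ≤ t → t ≤ 1 → ∃ x₀ : X, ∀ y : Y, φ x₀ y ≤ t * φ x₁ y + (1 - t) * φ x₂ y) →
      (∀ (y₁ y₂ : Y) (t : ℝ), 0 ≤ t → t ≤ 1 → ∃ y₀ : Y, ∀ x : X, t * φ x y₁ + (1 - t) * φ x y₂ ≤ φ x y₀) →
      ∀ γ : ℝ, (∀ x : X, ∃ y : Y, γ < φ x y) → ∃ y : Y, ∀ x : X, γ < φ x y := by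
  sorry

/-- **S3a `stub_cylindricalCombination`** — LINEAR COMBINATIONS OF CYLINDRICAL TEST FUNCTIONALS ARE
REALISED ON EVERY BALL: for reals `a, b`, a radius² `ρ` and cylindrical `Φ₁, Φ₂` there is ONE cylindrical
`Φ₀` with `Φ₀'(u) = aΦ₁'(u) + bΦ₂'(u)` (as test fields) at every `u` with `|u|² ≤ ρ`. Why true:
concatenate the coordinates (`m₀ = m₁ + m₂`, `g₀ = Fin.append g₁ g₂` via `Fin.addCases`), take the
profile `φ₀(z) = χ(z)·(a φ₁(π₁ z) + b φ₂(π₂ z))` with `π₁, π₂` the coordinate projections (continuous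
linear) and `χ` a `ContDiffBump` centred at `0` with `rIn` larger than the coordinate box of the ball
(`|(u, gᵢ)| ≤ |u|‖gᵢ‖_{L²}`, `Torus.abs_pairing_coe_le`): `φ₀ ∈ C¹_c` (`HasCompactSupport.mul_right`), and
on the ball `χ ≡ 1` near `coords₀ u` so `fderiv φ₀ = a (fderiv φ₁ ∘ π₁) + b (fderiv φ₂ ∘ π₂)`
(`Filter.EventuallyEq.fderiv_eq`, chain rule), whence `Φ₀'(u) = Σᵢ ∂ᵢφ₀ g₀ᵢ = aΦ₁'(u) + bΦ₂'(u)`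
(`Fin.sum_univ_add`). With `a = b = 0` it yields a test functional flat on the ball (the zero multiplier).
Size M. -/
theorem stub_cylindricalCombination :
    ∀ (ρ a b : ℝ) (Φ₁ Φ₂ : Torus.CylindricalTest (Fin 3)), ∃ Φ₀ : Torus.CylindricalTest (Fin 3),
      ∀ u : Torus.energySpace (Fin 3), ‖u‖ ^ 2 ≤ ρ → Φ₀.grad u = a • Φ₁.grad u + b • Φ₂.grad u := by
  sorry

/-- **S3 `stub_minimaxAlternative`** — THE MINIMAX ALTERNATIVE WITH SLOPE-BOUNDED MULTIPLIERS (strong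
duality in mean form on a dissipation sublevel set, tail included), GIVEN S0, S1, S2, S3a. For `ν > 0`,
smooth `f`, slope `L ≥ 0`, level `γ`, slack `η > 0`: EITHER some multiplier `(Φ, θ)` with `−L ≤ θ ≤ 0`
and `|⟨F(u),Φ'(u)⟩| ≤ L` on the Leray ball certifies `FloorIneq ν f Φ θ (γ − η)` at EVERY state, OR an
`(L, γ+η)`-APPROXIMATELY RELAXED statistic exists (probability measure carried by the ball, finite mean
enstrophy, integrable work and generators, `ε(μ) ≤ γ+η`, and penalised Lagrangian `≤ γ+η` against every
slope-`L` multiplier). Why true: put `ρ = 16‖f‖²/ν²`, `F = ‖f‖_{L²}`, `c = L(1 + 2F√ρ) + |γ| + η + 1`;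
game `X = {μ ∈ ProbabilityMeasure H : μ-a.e. |u|² ≤ ρ, ∫⁻‖∇u‖² ≤ c/ν}` (a `CompactSpace` by S1, contains
`δ_u` for every ball state with `ν‖∇u‖² ≤ c`), `Y = Y_L` (nonempty: the flat test of S3a with `θ = 0`;
`nsGeneratorPairing_sum_smul` with an empty sum gives `⟨F(u), 0⟩ = 0`),
`φ(μ,(Φ,θ)) = ε(μ) + ∫⟨F,Φ'⟩dμ + 2θ(∫(u,f)dμ − ε(μ))`. Fan's hypotheses: lsc in `μ` — `(1−2θ)ε` is lsc
by S0 (compose with the continuous monotone `x ↦ (min x (c/ν)).toReal`, restrict to the subtype), the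
generator and work terms are CONTINUOUS in `μ` (integrands `continuous_nsGeneratorPairing_grad`,
`Torus.continuous_pairing_coe`, bounded on the ball by `exists_abs_nsGeneratorPairing_grad_le` /
`Torus.abs_pairing_coe_le`; replace them by bounded continuous functions agreeing on the ball via the
radial retraction `u ↦ min(1, √ρ/|u|)•u`, then `ProbabilityMeasure.continuous_integral_boundedContinuousFunction`);
convex-like in `μ` — mix (`t•μ₁ + (1−t)•μ₂` stays in `X`, `φ` is affine in `μ`); concave-like in `y` —
`θ₀ = tθ₁ + (1−t)θ₂` and `Φ₀` from S3a with `(a,b) = (t, 1−t)`: `⟨F,Φ₀'⟩ = t⟨F,Φ₁'⟩ + (1−t)⟨F,Φ₂'⟩` on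
the ball (`nsGeneratorPairing_sum_smul`), so `Φ₀ ∈ Y_L` and `φ(μ,y₀) = tφ(μ,y₁) + (1−t)φ(μ,y₂)` on `X`.
Alternative: if NO `μ` is approximately relaxed, every `μ ∈ X` is beaten above `γ + η` (by the flat
multiplier when `ε(μ) > γ+η`); S2 at level `γ` gives ONE `y ∈ Y_L` beating all of `X`; Diracs
(`integral_dirac`, `lintegral_dirac`) give `L_y(u) > γ` at ball states with `ν‖∇u‖² ≤ c`, and the TAIL
pays by itself: `L_y(u) = (1−2θ)D + ⟨F,Φ'⟩ + 2θ(u,f) ≥ D − L − 2L√ρF > |γ| ≥ γ − η`. Size L− (hardest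
provable-now stub). -/
theorem stub_minimaxAlternative :
    (LowerSemicontinuous fun μ : ProbabilityMeasure (Torus.energySpace (Fin 3)) =>
      Torus.ensembleEnstrophy (μ : Measure (Torus.energySpace (Fin 3)))) →
    (∀ (ρ : ℝ) (c : ℝ≥0∞), c ≠ ⊤ →
      IsCompact {μ : ProbabilityMeasure (Torus.energySpace (Fin 3)) |
        (∀ᵐ u ∂(μ : Measure (Torus.energySpace (Fin 3))), ‖u‖ ^ 2 ≤ ρ) ∧
          Torus.ensembleEnstrophy (μ : Measure (Torus.energySpace (Fin 3))) ≤ c}) →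
    (∀ (X Y : Type) [TopologicalSpace X] [CompactSpace X] [Nonempty Y] (φ : X → Y → ℝ),
      (∀ y : Y, LowerSemicontinuous fun x : X => φ x y) →
      (∀ (x₁ x₂ : X) (t : ℝ), 0 ≤ t → t ≤ 1 → ∃ x₀ : X, ∀ y : Y, φ x₀ y ≤ t * φ x₁ y + (1 - t) * φ x₂ y) →
      (∀ (y₁ y₂ : Y) (t : ℝ), 0 ≤ t → t ≤ 1 → ∃ y₀ : Y, ∀ x : X, t * φ x y₁ + (1 - t) * φ x y₂ ≤ φ x y₀) →
      ∀ γ : ℝ, (∀ x : X, ∃ y : Y, γ < φ x y) → ∃ y : Y, ∀ x : X, γ < φ x y) →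
    (∀ (ρ a b : ℝ) (Φ₁ Φ₂ : Torus.CylindricalTest (Fin 3)), ∃ Φ₀ : Torus.CylindricalTest (Fin 3),
      ∀ u : Torus.energySpace (Fin 3), ‖u‖ ^ 2 ≤ ρ → Φ₀.grad u = a • Φ₁.grad u + b • Φ₂.grad u) →
    ∀ (ν : ℝ) (f : UnitAddTorus (Fin 3) → EuclideanSpace ℝ (Fin 3)), 0 < ν → Torus.IsSmooth f →
    ∀ (L γ η : ℝ), 0 ≤ L → 0 < η →
      (∃ (Φ : Torus.CylindricalTest (Fin 3)) (θ : ℝ), -L ≤ θ ∧ θ ≤ 0 ∧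
          (∀ u : Torus.energySpace (Fin 3), ‖u‖ ^ 2 ≤ 16 * (∫ x, ‖f x‖ ^ 2) / ν ^ 2 →
            |Torus.nsGeneratorPairing ν f u (Φ.grad u)| ≤ L) ∧
          ∀ u : Torus.energySpace (Fin 3), FloorIneq ν f Φ θ (γ - η) u) ∨
        ∃ μ : Measure (Torus.energySpace (Fin 3)),
          IsProbabilityMeasure μ ∧
          (∀ᵐ u ∂μ, ‖u‖ ^ 2 ≤ 16 * (∫ x, ‖f x‖ ^ 2) / ν ^ 2) ∧
          Torus.ensembleEnstrophy μ < ⊤ ∧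
          Integrable (fun u : Torus.energySpace (Fin 3) => Torus.pairing u.1 f) μ ∧
          (∀ Φ : Torus.CylindricalTest (Fin 3),
            Integrable (fun u => Torus.nsGeneratorPairing ν f u (Φ.grad u)) μ) ∧
          Torus.ensembleDissipation ν μ ≤ γ + η ∧
          ∀ (Φ : Torus.CylindricalTest (Fin 3)) (θ : ℝ), -L ≤ θ → θ ≤ 0 →
            (∀ u : Torus.energySpace (Fin 3), ‖u‖ ^ 2 ≤ 16 * (∫ x, ‖f x‖ ^ 2) / ν ^ 2 →
              |Torus.nsGeneratorPairing ν f u (Φ.grad u)| ≤ L) →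
            Torus.ensembleDissipation ν μ + ∫ u, Torus.nsGeneratorPairing ν f u (Φ.grad u) ∂μ +
                2 * θ * ((∫ u, Torus.pairing u.1 f ∂μ) - Torus.ensembleDissipation ν μ) ≤ γ + η := by
  sorry

/-- **S4 `stub_penalisationLimit`** — THE PENALISATION LIMIT, GIVEN S0, S1, S3a. For `ν > 0` and smooth
`f`: if for every `n : ℕ` there is an `(n, M)`-approximately relaxed statistic `μₙ`, then an EXACT relaxed
stationary statistic of mean dissipation `≤ M` exists. Why true: (i) `ε(μₙ) ≤ M` puts every `μₙ` in the
compact set of S1 (`ρ` = Leray radius², `c = M/ν`), so the sequence has a CLUSTER POINT `μ` there (no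
metrisability needed: work along the filter `𝓝 μ ⊓ map μs atTop`, which is `NeBot`, finer than the tails
of the sequence and convergent to `μ`; `ProbabilityMeasure.tendsto_iff_forall_integral_tendsto` holds for
any filter): `μ` is a probability measure carried by the closed ball with `∫⁻‖∇u‖²dμ ≤ M/ν` — i.e.
`ε(μ) ≤ M` and finite mean enstrophy; moreover `ε(μ) ≤ liminf ε(μₙ)` along the filter by S0.
(ii) Liouville: fix `Φ`, `|⟨F,Φ'⟩| ≤ C_Φ` on the ball (`exists_abs_nsGeneratorPairing_grad_le`); for
`k ≥ 1` and `n ≥ kC_Φ` test `μₙ` with `(±kΦ, θ = 0)` (realised on the ball by S3a with `(a,b) = (±k,0)`,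
slope `≤ n`; `nsGeneratorPairing_sum_smul`): `ε(μₙ) ± k∫⟨F,Φ'⟩dμₙ ≤ M` and `ε ≥ 0` give
`|∫⟨F,Φ'⟩dμₙ| ≤ M/k`; the integrand is continuous (`continuous_nsGeneratorPairing_grad`) and bounded on the
ball, all measures are carried by the ball (retract to a bounded continuous function), so
`|∫⟨F,Φ'⟩dμ| ≤ M/k` for every `k`, i.e. `= 0`; integrable (bounded, measurable). (iii) Energy: test
`μₙ` with the flat multiplier (S3a, `a = b = 0`) and `θ = −n`: `ε(μₙ) + 2n(ε(μₙ) − ∫(u,f)dμₙ) ≤ M`, so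
`ε(μₙ) − ∫(u,f)dμₙ ≤ M/(2n) → 0`; `∫(u,f)dμₙ → ∫(u,f)dμ` (`Torus.continuous_pairing_coe`, bounded on the
ball) and `ε(μ) ≤ liminf ε(μₙ)` give `ε(μ) ≤ ∫(u,f)dμ`. (iv) `(u,f)` integrable (bounded on the ball).
If `M < 0` the hypothesis is void (`ε ≥ 0`). Size M. -/
theorem stub_penalisationLimit :
    (LowerSemicontinuous fun μ : ProbabilityMeasure (Torus.energySpace (Fin 3)) =>
      Torus.ensembleEnstrophy (μ : Measure (Torus.energySpace (Fin 3)))) →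
    (∀ (ρ : ℝ) (c : ℝ≥0∞), c ≠ ⊤ →
      IsCompact {μ : ProbabilityMeasure (Torus.energySpace (Fin 3)) |
        (∀ᵐ u ∂(μ : Measure (Torus.energySpace (Fin 3))), ‖u‖ ^ 2 ≤ ρ) ∧
          Torus.ensembleEnstrophy (μ : Measure (Torus.energySpace (Fin 3))) ≤ c}) →
    (∀ (ρ a b : ℝ) (Φ₁ Φ₂ : Torus.CylindricalTest (Fin 3)), ∃ Φ₀ : Torus.CylindricalTest (Fin 3),
      ∀ u : Torus.energySpace (Fin 3), ‖u‖ ^ 2 ≤ ρ → Φ₀.grad u = a • Φ₁.grad u + b • Φ₂.grad u) →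
    ∀ (ν : ℝ) (f : UnitAddTorus (Fin 3) → EuclideanSpace ℝ (Fin 3)), 0 < ν → Torus.IsSmooth f →
    ∀ (M : ℝ) (μs : ℕ → Measure (Torus.energySpace (Fin 3))),
      (∀ n : ℕ,
        IsProbabilityMeasure (μs n) ∧
        (∀ᵐ u ∂(μs n), ‖u‖ ^ 2 ≤ 16 * (∫ x, ‖f x‖ ^ 2) / ν ^ 2) ∧
        Torus.ensembleEnstrophy (μs n) < ⊤ ∧
        Integrable (fun u : Torus.energySpace (Fin 3) => Torus.pairing u.1 f) (μs n) ∧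
        (∀ Φ : Torus.CylindricalTest (Fin 3),
          Integrable (fun u => Torus.nsGeneratorPairing ν f u (Φ.grad u)) (μs n)) ∧
        Torus.ensembleDissipation ν (μs n) ≤ M ∧
        ∀ (Φ : Torus.CylindricalTest (Fin 3)) (θ : ℝ), -(n : ℝ) ≤ θ → θ ≤ 0 →
          (∀ u : Torus.energySpace (Fin 3), ‖u‖ ^ 2 ≤ 16 * (∫ x, ‖f x‖ ^ 2) / ν ^ 2 →
            |Torus.nsGeneratorPairing ν f u (Φ.grad u)| ≤ (n : ℝ)) →
          Torus.ensembleDissipation ν (μs n) + ∫ u, Torus.nsGeneratorPairing ν f u (Φ.grad u) ∂(μs n) +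
              2 * θ * ((∫ u, Torus.pairing u.1 f ∂(μs n)) - Torus.ensembleDissipation ν (μs n)) ≤ M) →
      ∃ μ : Measure (Torus.energySpace (Fin 3)),
        (IsProbabilityMeasure μ ∧
          (∀ᵐ u ∂μ, ‖u‖ ^ 2 ≤ 16 * (∫ x, ‖f x‖ ^ 2) / ν ^ 2) ∧
          Torus.ensembleEnstrophy μ < ⊤ ∧
          (∀ Φ : Torus.CylindricalTest (Fin 3),
            Integrable (fun u => Torus.nsGeneratorPairing ν f u (Φ.grad u)) μ ∧
              ∫ u, Torus.nsGeneratorPairing ν f u (Φ.grad u) ∂μ = 0) ∧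
          Integrable (fun u : Torus.energySpace (Fin 3) => Torus.pairing u.1 f) μ ∧
          Torus.ensembleDissipation ν μ ≤ ∫ u, Torus.pairing u.1 f ∂μ) ∧
        Torus.ensembleDissipation ν μ ≤ M := by
  sorry

/-- **S5 `stub_relaxedEnsembleFloor`** — THE TRANSFER TARGET `C⁺` (OPEN; the bet; HARDEST; held by the
lead). Some smooth solenoidal mean-zero force has a UNIFORM RELAXED-ENSEMBLE FLOOR: `ε₀, ν₀ > 0` such
that for `ν ∈ (0, ν₀)` every relaxed stationary statistic of `NS_ν(f)` on the Leray ball — a Borel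
probability measure on `H` carried by `{|u|² ≤ 16‖f‖²/ν²}`, of finite mean enstrophy, annihilating
every cylindrical Liouville functional, with `u ↦ (u,f)` integrable and the ONE global mean energy
inequality `ν∫‖∇u‖²dμ ≤ ∫(u,f)dμ` — dissipates at least `ε₀`. NECESSARY for the crux
(`relaxedEnsembleFloor_of_floorCertificate`, PROVED below), equivalent to it given S0–S4. Why it might
fail: quiet invariant objects for every force (quiet steady branches continuing forced steady Euler
states; warm sheltered shears `|u|² ≍ ν^{-2/3}`; quiet relaxed-but-not-FMRT measures). First cuts on
record: regime split `uniformRelaxedFloor_of_split` (PROVED below); at the gravest Kolmogorov force `f_K`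
the anti-pumping work bound of `Lines/marchioro-force-floor.lean` S2. -/
theorem stub_relaxedEnsembleFloor :
    ∃ f : UnitAddTorus (Fin 3) → EuclideanSpace ℝ (Fin 3),
      Torus.IsSmooth f ∧ Torus.IsDivFree f ∧ Torus.HasZeroMean f ∧
      ∃ ε₀ ν₀ : ℝ, 0 < ε₀ ∧ 0 < ν₀ ∧ ∀ ν : ℝ, 0 < ν → ν < ν₀ →
        ∀ μ : Measure (Torus.energySpace (Fin 3)),
          IsProbabilityMeasure μ →
          (∀ᵐ u ∂μ, ‖u‖ ^ 2 ≤ 16 * (∫ x, ‖f x‖ ^ 2) / ν ^ 2) →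
          Torus.ensembleEnstrophy μ < ⊤ →
          (∀ Φ : Torus.CylindricalTest (Fin 3),
            Integrable (fun u => Torus.nsGeneratorPairing ν f u (Φ.grad u)) μ ∧
              ∫ u, Torus.nsGeneratorPairing ν f u (Φ.grad u) ∂μ = 0) →
          Integrable (fun u : Torus.energySpace (Fin 3) => Torus.pairing u.1 f) μ →
          Torus.ensembleDissipation ν μ ≤ ∫ u, Torus.pairing u.1 f ∂μ →
          ε₀ ≤ Torus.ensembleDissipation ν μ := by
  sorry

/-! ## Vocabulary of the composition (definitional abbreviations; bridged to the stubs by `Iff.rfl`) -/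

/-- Squared Leray radius `16‖f‖²/ν²` (verbatim the crux's ball). -/
def lerayRadiusSq (f : Vec3) (ν : ℝ) : ℝ := 16 * (∫ x, ‖f x‖ ^ 2) / ν ^ 2

/-- **RELAXED STATIONARY STATISTIC** of `NS_ν(f)` on the Leray ball — the EXACT dual object of the crux's
certificate class: a Borel probability measure on `H` carried by the Leray ball, of finite mean
enstrophy, annihilating every cylindrical Liouville functional (dual to the free multiplier `Φ₁`) and
obeying the ONE global mean energy inequality (dual to `θ₁ ≤ 0`). Strictly larger than FMRT's class
(`isRelaxed_of_isStationary`). A conjunction, definitionally the hypothesis block of S5 / conclusion of S4. -/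
def IsRelaxedStatistic (ν : ℝ) (f : Vec3) (μ : Measure H3) : Prop :=
  IsProbabilityMeasure μ ∧
    (∀ᵐ u ∂μ, ‖u‖ ^ 2 ≤ 16 * (∫ x, ‖f x‖ ^ 2) / ν ^ 2) ∧
    Torus.ensembleEnstrophy μ < ⊤ ∧
    (∀ Φ : Torus.CylindricalTest (Fin 3),
      Integrable (fun u => Torus.nsGeneratorPairing ν f u (Φ.grad u)) μ ∧
        ∫ u, Torus.nsGeneratorPairing ν f u (Φ.grad u) ∂μ = 0) ∧
    Integrable (fun u : H3 => Torus.pairing u.1 f) μ ∧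
    Torus.ensembleDissipation ν μ ≤ ∫ u, Torus.pairing u.1 f ∂μ

/-- **`(L, M)`-APPROXIMATELY RELAXED STATISTIC** (second horn of S3, input of S4): a probability measure
carried by the Leray ball with finite mean enstrophy and mean dissipation `≤ M` whose PENALISED
Lagrangian stays `≤ M` against every multiplier of the slope-bounded class
`Y_L = {(Φ, θ) : −L ≤ θ ≤ 0, |⟨F(u),Φ'(u)⟩| ≤ L on the ball}`. Definitionally the block in S3/S4. -/
def IsApproxRelaxed (ν : ℝ) (f : Vec3) (L M : ℝ) (μ : Measure H3) : Prop :=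
  IsProbabilityMeasure μ ∧
    (∀ᵐ u ∂μ, ‖u‖ ^ 2 ≤ 16 * (∫ x, ‖f x‖ ^ 2) / ν ^ 2) ∧
    Torus.ensembleEnstrophy μ < ⊤ ∧
    Integrable (fun u : H3 => Torus.pairing u.1 f) μ ∧
    (∀ Φ : Torus.CylindricalTest (Fin 3), Integrable (fun u => Torus.nsGeneratorPairing ν f u (Φ.grad u)) μ) ∧
    Torus.ensembleDissipation ν μ ≤ M ∧
    ∀ (Φ : Torus.CylindricalTest (Fin 3)) (θ : ℝ), -L ≤ θ → θ ≤ 0 →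
      (∀ u : H3, ‖u‖ ^ 2 ≤ 16 * (∫ x, ‖f x‖ ^ 2) / ν ^ 2 → |Torus.nsGeneratorPairing ν f u (Φ.grad u)| ≤ L) →
      Torus.ensembleDissipation ν μ + ∫ u, Torus.nsGeneratorPairing ν f u (Φ.grad u) ∂μ +
          2 * θ * ((∫ u, Torus.pairing u.1 f ∂μ) - Torus.ensembleDissipation ν μ) ≤ M

/-- The UNIFORM RELAXED-ENSEMBLE FLOOR of a force `f` (the dual form of the crux AT `f`): below `ν₀` every
relaxed stationary statistic of `NS_ν(f)` on the Leray ball dissipates at least `ε₀` in the mean. -/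
def UniformRelaxedFloor (f : Vec3) : Prop :=
  ∃ ε₀ ν₀ : ℝ, 0 < ε₀ ∧ 0 < ν₀ ∧ ∀ ν : ℝ, 0 < ν → ν < ν₀ →
    ∀ μ : Measure H3, IsRelaxedStatistic ν f μ → ε₀ ≤ Torus.ensembleDissipation ν μ

/-- S5 folded: some admissible force has a uniform relaxed-ensemble floor (from `stub_relaxedEnsembleFloor`
by currying the conjunction `IsRelaxedStatistic`). -/
theorem relaxedEnsembleFloor :
    ∃ f : Vec3, Torus.IsSmooth f ∧ Torus.IsDivFree f ∧ Torus.HasZeroMean f ∧ UniformRelaxedFloor f := by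
  obtain ⟨f, hfs, hfd, hfz, ε₀, ν₀, hε₀, hν₀, h⟩ := stub_relaxedEnsembleFloor
  exact ⟨f, hfs, hfd, hfz, ε₀, ν₀, hε₀, hν₀, fun ν hν hνlt μ hμ =>
    h ν hν hνlt μ hμ.1 hμ.2.1 hμ.2.2.1 hμ.2.2.2.1 hμ.2.2.2.2.1 hμ.2.2.2.2.2⟩

/-! ## Proved: weak duality for the relaxed class, exactness, FMRT ⊂ relaxed, the regime split -/

/-- Floors are monotone in the budget. -/
theorem floorIneq_mono {ν : ℝ} {f : Vec3} {Φ : Torus.CylindricalTest (Fin 3)} {θ ε ε' : ℝ} {u : H3}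
    (h : FloorIneq ν f Φ θ ε u) (hle : ε' ≤ ε) : FloorIneq ν f Φ θ ε' u :=
  fun h1 h2 => hle.trans (h h1 h2)

/-- **WEAK DUALITY for the relaxed class (PROVED).** A floor family for `(f, ε, ν)` bounds the mean
dissipation of EVERY relaxed stationary statistic of `NS_ν(f)` on the Leray ball from below: the floor
holds `μ`-a.e. (finite enstrophy a.e., carried by the ball), integrate, the Liouville identity kills the
generator term, `θ₁ ≤ 0` and the global energy inequality sign the energy channel away. The relaxed-class
form of the landed `Negative.floorFamily_le_ensembleDissipation`. -/
theorem weak_duality {ν : ℝ} {f : Vec3} {ε : ℝ} (hfl : FloorFamily f ε ν) {μ : Measure H3}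
    (hμ : IsRelaxedStatistic ν f μ) : ε ≤ Torus.ensembleDissipation ν μ := by
  obtain ⟨Φ₁, θ₁, hθ₁, hfloor⟩ := hfl
  obtain ⟨hprob, hball, hZ, hLiou, hB, hE⟩ := hμ
  haveI := hprob
  set G : H3 → ℝ≥0∞ := fun u => Torus.eGradNormSq ((u : L2) : Vec3) with hG
  have hGm : Measurable G := Torus.measurable_eGradNormSq_coe
  have hGfin : ∫⁻ u, G u ∂μ < ∞ := hZ
  have hGlt : ∀ᵐ u ∂μ, G u < ∞ := ae_lt_top hGm hGfin.ne
  have hA : Integrable (fun u => (G u).toReal) μ :=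
    integrable_toReal_of_lintegral_ne_top hGm.aemeasurable hGfin.ne
  obtain ⟨hC, hC0⟩ := hLiou Φ₁
  -- the FLOOR holds `μ`-a.e.
  have hae : ∀ᵐ u ∂μ, ε ≤ ν * (G u).toReal + Torus.nsGeneratorPairing ν f u (Φ₁.grad u) +
      2 * θ₁ * (Torus.pairing (u : L2) f - ν * (G u).toReal) := by
    filter_upwards [hGlt, hball] with u hu hb
    exact hfloor u hu.ne hb
  -- integrate
  have h1 : Integrable (fun u : H3 => ν * (G u).toReal) μ := hA.const_mul ν
  have h2 : Integrable (fun u : H3 => ν * (G u).toReal + Torus.nsGeneratorPairing ν f u (Φ₁.grad u)) μ :=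
    h1.add hC
  have h3 : Integrable (fun u : H3 => Torus.pairing (u : L2) f - ν * (G u).toReal) μ := hB.sub h1
  have h4 : Integrable (fun u : H3 => 2 * θ₁ * (Torus.pairing (u : L2) f - ν * (G u).toReal)) μ :=
    h3.const_mul _
  have hint : Integrable (fun u : H3 => ν * (G u).toReal + Torus.nsGeneratorPairing ν f u (Φ₁.grad u) +
      2 * θ₁ * (Torus.pairing (u : L2) f - ν * (G u).toReal)) μ := h2.add h4
  have hmono := integral_mono_ae (integrable_const ε) hint hae
  have hconst : ∫ _ : H3, ε ∂μ = ε := by simp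
  have hsplit : ∫ u : H3, (ν * (G u).toReal + Torus.nsGeneratorPairing ν f u (Φ₁.grad u) +
      2 * θ₁ * (Torus.pairing (u : L2) f - ν * (G u).toReal)) ∂μ =
      ν * (∫⁻ u, G u ∂μ).toReal + 0 +
        2 * θ₁ * (∫ u : H3, Torus.pairing (u : L2) f ∂μ - ν * (∫⁻ u, G u ∂μ).toReal) := by
    rw [integral_add h2 h4, integral_add h1 hC, integral_const_mul, integral_const_mul, integral_sub hB h1,
      integral_const_mul, hC0, integral_toReal hGm.aemeasurable hGlt]
  rw [hconst, hsplit] at hmono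
  -- the global energy inequality `ν ∫‖∇u‖² ≤ ∫ (u,f)`
  have hE' : ν * (∫⁻ u, G u ∂μ).toReal ≤ ∫ u, Torus.pairing (u : L2) f ∂μ := hE
  have hθ : 2 * θ₁ * (∫ u, Torus.pairing (u : L2) f ∂μ - ν * (∫⁻ u, G u ∂μ).toReal) ≤ 0 :=
    mul_nonpos_of_nonpos_of_nonneg (by linarith) (by linarith)
  change ε ≤ ν * (∫⁻ u, G u ∂μ).toReal
  linarith

/-- **EXACTNESS (PROVED): the crux implies S5.** `FloorCertificate` gives a force with a uniform
relaxed-ensemble floor, by weak duality — so S5 is NECESSARY for the crux, and with S0–S4 equivalent to it. -/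
theorem relaxedEnsembleFloor_of_floorCertificate (h : FloorCertificate) :
    ∃ f : Vec3, Torus.IsSmooth f ∧ Torus.IsDivFree f ∧ Torus.HasZeroMean f ∧ UniformRelaxedFloor f := by
  rw [floorCertificate_iff] at h
  obtain ⟨f, hfs, hfd, hfz, ε₀, ν₀, hε₀, hν₀, hcert⟩ := h
  exact ⟨f, hfs, hfd, hfz, ε₀, ν₀, hε₀, hν₀, fun ν hν hνlt μ hμ => weak_duality (hcert ν hν hνlt) hμ⟩

/-- **FMRT ⊂ RELAXED (PROVED).** Every stationary statistical solution of `NS_ν(f)` (FMRT IV Def. 1.3,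
`ν > 0`, `f` smooth) is a relaxed stationary statistic on the Leray ball: support bound (1.34) ⊂ Leray
ball (`ae_norm_le`, `ball_of_norm_le`), finite mean enstrophy (1.29), the Liouville equation (1.30), and
the shell inequality (1.31) at `(0, ∞)` (`energy_le_holds`). -/
theorem isRelaxed_of_isStationary {ν : ℝ} (hν : 0 < ν) {f : Vec3} (hfs : Torus.IsSmooth f)
    {μ : Measure H3} (hμ : Torus.IsStationaryStatisticalSolution ν f μ) : IsRelaxedStatistic ν f μ := by
  have hf : MemLp f 2 volume := hfs.memLp 2
  refine ⟨hμ.prob, ?_, hμ.enstrophy_finite, hμ.generator, hμ.integrable_pairing hf, ?_⟩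
  · filter_upwards [hμ.ae_norm_le hν hf] with u hu
    exact ball_of_norm_le hν hf hu
  · exact Torus.IsStationaryStatisticalSolution.energy_le_holds hμ hf

/-- **What S5 buys physically (PROVED): the ensemble zeroth-law floor over FMRT statistics** of the
witness force — the exact negation lane of the disprover's `QuietStatistics` (Disproof.lean §C). -/
theorem fmrt_loud_of_uniformRelaxedFloor {f : Vec3} (hfs : Torus.IsSmooth f) (h : UniformRelaxedFloor f) :
    ∃ ε₀ ν₀ : ℝ, 0 < ε₀ ∧ 0 < ν₀ ∧ ∀ ν : ℝ, 0 < ν → ν < ν₀ → ∀ μ : Measure H3,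
      Torus.IsStationaryStatisticalSolution ν f μ → ε₀ ≤ Torus.ensembleDissipation ν μ := by
  obtain ⟨ε₀, ν₀, hε₀, hν₀, h⟩ := h
  exact ⟨ε₀, ν₀, hε₀, hν₀, fun ν hν hνlt μ hμ => h ν hν hνlt μ (isRelaxed_of_isStationary hν hfs hμ)⟩

/-- Bounded-energy half of S5 at `f` (the DODGER regime): for every energy cap `E`, the relaxed statistics
of mean energy `≤ E` are uniformly loud as `ν → 0`. -/
def NoQuietBoundedEnergyStatistics (f : Vec3) : Prop :=
  ∀ E : ℝ, ∃ ε ν₁ : ℝ, 0 < ε ∧ 0 < ν₁ ∧ ∀ ν : ℝ, 0 < ν → ν < ν₁ →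
    ∀ μ : Measure H3, IsRelaxedStatistic ν f μ → Torus.ensembleEnergy μ ≤ E → ε ≤ Torus.ensembleDissipation ν μ

/-- Fat half of S5 at `f` (the WARM regime): above SOME energy cap `E`, relaxed statistics are uniformly
loud as `ν → 0`. -/
def NoQuietFatStatistics (f : Vec3) : Prop :=
  ∃ E ε ν₁ : ℝ, 0 < ε ∧ 0 < ν₁ ∧ ∀ ν : ℝ, 0 < ν → ν < ν₁ →
    ∀ μ : Measure H3, IsRelaxedStatistic ν f μ → E ≤ Torus.ensembleEnergy μ → ε ≤ Torus.ensembleDissipation ν μ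

/-- **REGIME SPLIT of S5 (PROVED glue):** the two halves give the uniform relaxed floor of `f`. -/
theorem uniformRelaxedFloor_of_split {f : Vec3} (hb : NoQuietBoundedEnergyStatistics f)
    (hf : NoQuietFatStatistics f) : UniformRelaxedFloor f := by
  obtain ⟨E, ε₂, ν₂, hε₂, hν₂, hfat⟩ := hf
  obtain ⟨ε₁, ν₁, hε₁, hν₁, hbdd⟩ := hb E
  refine ⟨min ε₁ ε₂, min ν₁ ν₂, lt_min hε₁ hε₂, lt_min hν₁ hν₂, fun ν hν hνlt μ hμ => ?_⟩
  rcases le_total (Torus.ensembleEnergy μ) E with hle | hge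
  · exact (min_le_left _ _).trans (hbdd ν hν (lt_of_lt_of_le hνlt (min_le_left _ _)) μ hμ hle)
  · exact (min_le_right _ _).trans (hfat ν hν (lt_of_lt_of_le hνlt (min_le_right _ _)) μ hμ hge)

/-- Converse of the regime split (same constants). -/
theorem split_of_uniformRelaxedFloor {f : Vec3} (h : UniformRelaxedFloor f) :
    NoQuietBoundedEnergyStatistics f ∧ NoQuietFatStatistics f := by
  obtain ⟨ε₀, ν₀, hε₀, hν₀, h⟩ := h
  exact ⟨fun E => ⟨ε₀, ν₀, hε₀, hν₀, fun ν hν hνlt μ hμ _ => h ν hν hνlt μ hμ⟩,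
    ⟨0, ε₀, ν₀, hε₀, hν₀, fun ν hν hνlt μ hμ _ => h ν hν hνlt μ hμ⟩⟩

/-! ## The composition: `FloorCertificate` from S0–S5 -/

/-- The minimax alternative (S3 fed S0, S1, S2, S3a), folded. -/
theorem minimaxAlternative {ν : ℝ} {f : Vec3} (hν : 0 < ν) (hfs : Torus.IsSmooth f) (L γ η : ℝ)
    (hL : 0 ≤ L) (hη : 0 < η) :
    (∃ (Φ : Torus.CylindricalTest (Fin 3)) (θ : ℝ), -L ≤ θ ∧ θ ≤ 0 ∧
        (∀ u : H3, ‖u‖ ^ 2 ≤ 16 * (∫ x, ‖f x‖ ^ 2) / ν ^ 2 → |Torus.nsGeneratorPairing ν f u (Φ.grad u)| ≤ L) ∧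
        ∀ u : H3, FloorIneq ν f Φ θ (γ - η) u) ∨
      ∃ μ : Measure H3, IsApproxRelaxed ν f L (γ + η) μ :=
  stub_minimaxAlternative stub_lscEnstrophy (stub_sublevelCompact stub_lscEnstrophy) stub_fanMinimax
    stub_cylindricalCombination ν f hν hfs L γ η hL hη

/-- The penalisation limit (S4 fed S0, S1, S3a), folded. -/
theorem penalisationLimit {ν : ℝ} {f : Vec3} (hν : 0 < ν) (hfs : Torus.IsSmooth f) (M : ℝ)
    (μs : ℕ → Measure H3) (hμs : ∀ n : ℕ, IsApproxRelaxed ν f n M (μs n)) :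
    ∃ μ : Measure H3, IsRelaxedStatistic ν f μ ∧ Torus.ensembleDissipation ν μ ≤ M :=
  stub_penalisationLimit stub_lscEnstrophy (stub_sublevelCompact stub_lscEnstrophy)
    stub_cylindricalCombination ν f hν hfs M μs hμs

/-- **`FloorCertificate` from the seven stubs (kernel-checked; no `sorry` of its own).** Take the force
`f` and `(ε₀, ν₀)` of S5 and answer the crux with `(f, ε₀/2, ν₀)`. At `ν ∈ (0, ν₀)` suppose no floor
family with budget `ε₀/2` exists. For every `n : ℕ` run the alternative S3 at slope `L = n`, level
`γ = 3ε₀/4`, slack `η = ε₀/8`: its first horn is a floor family with budget `5ε₀/8 ≥ ε₀/2` — excluded —,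
so its second horn supplies an `(n, 7ε₀/8)`-approximately relaxed statistic `μₙ`. The penalisation
limit S4 turns `(μₙ)` into an exact relaxed stationary statistic of mean dissipation `≤ 7ε₀/8 < ε₀`,
contradicting S5. Pure logic and linear arithmetic beyond the stubs. -/
theorem FloorCertificate_of : FloorCertificate := by
  obtain ⟨f, hfs, hfd, hfz, ε₀, ν₀, hε₀, hν₀, hC⟩ := relaxedEnsembleFloor
  rw [floorCertificate_iff]
  refine ⟨f, hfs, hfd, hfz, ε₀ / 2, ν₀, half_pos hε₀, hν₀, fun ν hν hνlt => ?_⟩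
  by_contra hno
  have hB : ∀ n : ℕ, ∃ μ : Measure H3, IsApproxRelaxed ν f n (3 * ε₀ / 4 + ε₀ / 8) μ := by
    intro n
    rcases minimaxAlternative hν hfs n (3 * ε₀ / 4) (ε₀ / 8) (Nat.cast_nonneg n) (by positivity) with hA | hB
    · obtain ⟨Φ, θ, -, hθ0, -, hfloor⟩ := hA
      exact absurd ⟨Φ, θ, hθ0, fun u => floorIneq_mono (hfloor u) (by linarith)⟩ hno
    · exact hB
  choose μs hμs using hB
  obtain ⟨μ, hrel, hdiss⟩ := penalisationLimit hν hfs _ μs hμs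
  have hloud : ε₀ ≤ Torus.ensembleDissipation ν μ := hC ν hν hνlt μ hrel
  linarith

end Summit.AnomalousDissipation.AnomalousDissipation.Cruxes.FloorCertificate.DissipationDeficitDuality

end
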